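import Summits.BirchSwinnertonDyer.BirchSwinnertonDyer.Theorems.ByReductionTypeAtTwoSupersingularThetaHabitatPlusNegDisc
import Summits.BirchSwinnertonDyer.Rank1Residual.Supersingular.FrobeniusTraceTwoParity
import HarnessLib

/-!
# Route `ByReductionTypeAtTwo`, crux `SupersingularRankZeroAtTwo` (item stmt-BirchSwinnertonDyer-19097), THETA road:
# `a₂ = 0` is AUTOMATIC for a CM curve good supersingular at `2`, and the cert-free criterion
# «`a₂(E) = 0 ⟺ 32 ∣ c₄`, `a₂(E) = ±2 ⟺ 32 ∤ c₄`» for every curve good supersingular at `2`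
# (seat `bsd-2adic-ss-1x` GEN 2; `--supports 19097 --as helper`)

HONEST FRAMING (cell `pub/bsd-2adic`): THEOREMS ONLY (no definition, no named fact, no `sorry`); nothing about any
particular curve is asserted; nothing is booked; BSD is not proved by any of this.

## What this file proves

Route ThetaPartnerAtTwo's habitat clause, its cruxes K1/K2r0 and the W-ALL slice leaves all carry, for the CM partner
`A`, the hypothesis `A.frobeniusTrace 2 = 0` next to `GoodSS A 2`. It is REDUNDANT:

* §1 (every curve good supersingular at `2`) the globally minimal model has `a₁ = 2k` even and `a₃` odd (tree
  `even_a₁_and_odd_a₃_of_goodSS_two`), so `c₄ = 16(k² + a₂)² − 48(a₄ + k a₃) ≡ 16(a₂ + a₄) (mod 32)`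
  (`thirtytwo_dvd_c₄_iff_even`); with the tree's point count `a₂(E) = 0 ⟺ a₂ + a₄ even`
  (`frobeniusTrace_two_eq_zero_iff_even_a₂_add_a₄`, the four supersingular normal forms over `𝔽₂`) this is the
  CERT-FREE criterion **`a₂(E) = 0 ⟺ 32 ∣ c₄(E_min)`** (`frobeniusTrace_two_eq_zero_iff_dvd_c₄`), equivalently
  `a₂(E) = ±2 ⟺ 2⁴ ‖ c₄` — a class kit can read the sign `a₂ ∈ {0, ±2}` off `c₄` instead of counting points;
* §2 (CM) `2¹⁵ ∣ j(A)` for the seven `2`-inert CM `j`-invariants (the `2¹²`-divisible ones of the thirteen, file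
  `…ThetaHabitatPlusNegDisc` §2–§3), `j·Δ_min = c₄³` with `Δ_min` odd and `16 ∣ c₄` give `32 ∣ c₄`, hence
  **`frobeniusTrace_two_eq_zero_of_hasCM_of_goodSS_two`: every CM curve `A/ℚ` good supersingular at `2` has `a₂(A) = 0`**
  (the classical reason — `2` inert in the CM field, Frobenius `π₂² = −2·unit` — needs the reduction of CM
  endomorphisms, absent from the tree; this `2`-adic route needs only the `j`-list);
* §3 consequences for the theta road: the habitat clause of `WAllNonCMAtTwoThetaHabitat` / the unit-zone habitat needs
  only `A.HasCM ∧ GoodSS A 2` (+ rank / cert / `E[2] ≃ A[2]`) — `thetaHabitatClause_of_cm_goodSS`,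
  `unitZoneClause_of_cm_goodSS`.

References: [SilvermanAEC2009] III.§1 (`b₂, b₄, c₄`), V.2 (point counts), Appendix C §11 (CM `j`-invariants), V Ex. 5.7;
[Lang1987] Ch. 13 §4 Thm. 12 (Deuring: `a_p = 0` at an inert good prime — the statement, proved here at `p = 2` by other means).
-/

set_option autoImplicit false
-- the Theorems namespace of this sub repeats the summit name by design (D-0017 nested layout)
set_option linter.dupNamespace false

noncomputable section

open scoped Classical

open WeierstrassCurve Literature.NumberTheory.EllipticCurves
  Literature.NumberTheory.EllipticCurves.Rank1Residual
  Summit.BirchSwinnertonDyer.Rank1Residual Summit.BirchSwinnertonDyer.Rank1Residual.Supersingular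

namespace Summit.BirchSwinnertonDyer.BirchSwinnertonDyer.Theorems

namespace ThetaPartnerXRoute

/-! ## §1 `a₂(E) = 0 ⟺ 32 ∣ c₄` at a good supersingular `2` -/

section Criterion

/-- `c₄ ≡ 16·(a₂ + a₄) (mod 32)` for an integral equation with `a₁` even and `a₃` odd: with `a₁ = 2k`,
`c₄ = 16(k² + a₂)² − 48(a₄ + k·a₃)` and `(k² + a₂)² ≡ k + a₂`, `48 ≡ 16`, `16k·a₃ ≡ 16k (mod 32)`. Stated as:
`32 ∣ c₄ ↔ Even (a₂ + a₄)`. [cite: SilvermanAEC2009, III.§1 (p. 42)] -/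
theorem thirtytwo_dvd_c₄_iff_even (M : WeierstrassCurve ℤ) (h1 : Even M.a₁) (h3 : Odd M.a₃) :
    (32 : ℤ) ∣ M.c₄ ↔ Even (M.a₂ + M.a₄) := by
  obtain ⟨k, hk⟩ := h1
  obtain ⟨l, hl⟩ := h3
  -- `c₄ = 16(a₂ + a₄) + 16(k⁴ − k) + 32k²a₂ + 16(a₂ − 1)a₂ − 64a₄ − 96kl − 32k`
  have hc : M.c₄ = 16 * (M.a₂ + M.a₄) + 16 * (k ^ 4 - k) + 32 * (k ^ 2 * M.a₂) +
      16 * ((M.a₂ - 1) * (M.a₂ - 1 + 1)) - 64 * M.a₄ - 96 * (k * l) - 32 * k := by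
    simp only [WeierstrassCurve.c₄, WeierstrassCurve.b₂, WeierstrassCurve.b₄, hk, hl]; ring
  have e1 : Even (k ^ 4 - k) :=
    Int.even_sub.mpr ⟨fun h ↦ (Int.even_pow.mp h).1, fun h ↦ Int.even_pow.mpr ⟨h, by norm_num⟩⟩
  have e2 : Even ((M.a₂ - 1) * (M.a₂ - 1 + 1)) := Int.even_mul_succ_self _
  obtain ⟨u, hu⟩ := e1
  obtain ⟨v, hv⟩ := e2
  rw [hu, hv] at hc
  rw [Int.even_iff]
  constructor
  · rintro ⟨c, hc'⟩
    omega
  · intro h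
    exact Int.dvd_of_emod_eq_zero (by omega)

variable (W : WeierstrassCurve ℚ) [W.IsGloballyMinimal]

/-- **`a₂(E) = 0 ⟺ 32 ∣ c₄(E_min)` for a curve good supersingular at `2`** (cert-free sign criterion; the
point-count half is the tree's `frobeniusTrace_two_eq_zero_iff_even_a₂_add_a₄`). [cite: SilvermanAEC2009, V.2 and III.§1] -/
theorem frobeniusTrace_two_eq_zero_iff_dvd_c₄ (hss : GoodSS W 2) :
    W.frobeniusTrace 2 = 0 ↔ (32 : ℤ) ∣ (integralModelInt W).c₄ := by
  obtain ⟨h1, h3⟩ := even_a₁_and_odd_a₃_of_goodSS_two W hss.1 hss.2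
  rw [frobeniusTrace_two_eq_zero_iff_even_a₂_add_a₄ W hss.1 hss.2, thirtytwo_dvd_c₄_iff_even _ h1 h3]

/-- **`a₂(E) ≠ 0` (i.e. `a₂ = ±2`) `⟺ 32 ∤ c₄(E_min)`** at a good supersingular `2` (then `2⁴ ‖ c₄`, since `16 ∣ c₄`
always: `sixteen_dvd_c₄_of_even_a₁`). [cite: SilvermanAEC2009, V.2 and III.§1] -/
theorem frobeniusTrace_two_ne_zero_iff_not_dvd_c₄ (hss : GoodSS W 2) :
    W.frobeniusTrace 2 ≠ 0 ↔ ¬ (32 : ℤ) ∣ (integralModelInt W).c₄ :=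
  (frobeniusTrace_two_eq_zero_iff_dvd_c₄ W hss).not

end Criterion

/-! ## §2 CM curves good supersingular at `2` have `a₂ = 0` -/

section CM

/-- Among the thirteen CM `j`-invariants, the `2¹²`-divisible ones are in fact `2¹⁵`-divisible
(`0, −2¹⁵, −2¹⁵·3³, −2¹⁵·3·5³, −2¹⁸·3³·5³, −2¹⁵·(3·5·11)³, −2¹⁸·(3·5·23·29)³`).
[cite: SilvermanAEC2009, Appendix C §11 (the thirteen CM j-invariants)] -/
theorem dvd_of_mem_cmJInvariants_of_dvd {q : ℚ} (hq : q ∈ cmJInvariants) :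
    ∃ z : ℤ, (z : ℚ) = q ∧ ((4096 : ℤ) ∣ z → (32768 : ℤ) ∣ z) := by
  simp only [cmJInvariants, Finset.mem_insert, Finset.mem_singleton] at hq
  rcases hq with rfl | rfl | rfl | rfl | rfl | rfl | rfl | rfl | rfl | rfl | rfl | rfl | rfl
  exacts [⟨0, by norm_num, by omega⟩, ⟨1728, by norm_num, by omega⟩, ⟨-3375, by norm_num, by omega⟩,
    ⟨8000, by norm_num, by omega⟩, ⟨-32768, by norm_num, by omega⟩, ⟨54000, by norm_num, by omega⟩,
    ⟨287496, by norm_num, by omega⟩, ⟨-884736, by norm_num, by omega⟩,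
    ⟨-12288000, by norm_num, by omega⟩, ⟨16581375, by norm_num, by omega⟩,
    ⟨-884736000, by norm_num, by omega⟩, ⟨-147197952000, by norm_num, by omega⟩,
    ⟨-262537412640768000, by norm_num, by omega⟩]

variable (A : WeierstrassCurve ℚ) [A.IsElliptic] [A.IsGloballyMinimal]

/-- **A CM curve good supersingular at `2` has `32 ∣ c₄(A_min)`**: `j = z ∈ ℤ` with `2¹⁵ ∣ z` (§2 of the sibling
file gives `2¹² ∣ z`, hence `2¹⁵ ∣ z` on the list), `z·Δ_min = c₄³` with `16 ∣ c₄ = 16t`, so `2¹⁵ ∣ 2¹²·t³·(…)`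
— precisely `8 ∣ t³`, so `t` is even. [cite: SilvermanAEC2009, Appendix C §11 and III.§1] -/
theorem thirtytwo_dvd_c₄_of_hasCM_of_goodSS_two (hCM : A.HasCM) (hss : GoodSS A 2) :
    (32 : ℤ) ∣ (integralModelInt A).c₄ := by
  obtain ⟨z, hz, hz15⟩ := dvd_of_mem_cmJInvariants_of_dvd ((WeierstrassCurve.hasCM_iff_j_mem_holds A).mp hCM)
  have h4096 : (4096 : ℤ) ∣ z := dvd_of_goodSS_two_of_intCast_eq_j A hss hz
  have h32768 : (32768 : ℤ) ∣ z := hz15 h4096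
  obtain ⟨h1, h3⟩ := even_a₁_and_odd_a₃_of_goodSS_two A hss.1 hss.2
  set M := integralModelInt A with hM
  -- `z · Δ_min = c₄³`
  have hc₄ : (M.c₄ : ℚ) = A.c₄ := by
    have h := M.map_c₄ (Int.castRingHom ℚ)
    rw [hM, map_integralModelInt, eq_intCast] at h
    exact h.symm
  have hΔ : (M.Δ : ℚ) = A.Δ := cast_minimalDiscriminantInt A
  have hzΔ : z * M.Δ = M.c₄ ^ 3 := by
    have h := X12.j_mul_Δ_eq_c₄_pow A
    rw [← hz, ← hΔ, ← hc₄] at h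
    exact_mod_cast h
  -- `c₄ = 16 t`; `Δ` odd; `2¹⁵ ∣ 16³ t³ Δ`-free form: `2¹⁵ ∣ z ∣`… we argue on `t`
  obtain ⟨t, ht⟩ := sixteen_dvd_c₄_of_even_a₁ M h1
  obtain ⟨m, hm⟩ := odd_Δ_of_even_a₁_odd_a₃ M h1 h3
  -- `z = 32768 w`, so `32768 w Δ = 4096 t³`, i.e. `8 w Δ = t³`: `t³` even (as `Δ` is odd, parity of `8wΔ`)
  obtain ⟨w, hw⟩ := h32768
  have key : 8 * w * M.Δ = t ^ 3 := by
    have h : (32768 : ℤ) * w * M.Δ = (16 * t) ^ 3 := by rw [← hw, ← ht]; exact hzΔ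
    have h' : (4096 : ℤ) * (8 * w * M.Δ) = 4096 * t ^ 3 := by linear_combination h
    exact mul_left_cancel₀ (by norm_num) h'
  have ht3 : Even (t ^ 3) := ⟨4 * w * M.Δ, by rw [← key]; ring⟩
  have hteven : Even t := (Int.even_pow.mp ht3).1
  obtain ⟨s, hs⟩ := hteven
  exact ⟨s, by rw [ht, hs]; ring⟩

/-- **Every CM elliptic curve over `ℚ` with good supersingular reduction at `2` has `a₂ = 0`** (the hypothesis
`A.frobeniusTrace 2 = 0` of route ThetaPartnerAtTwo's habitat clause and of its cruxes K1/K2r0 at the CM partner is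
redundant). [cite: Lang1987, Ch. 13 §4 Thm. 12] [cite: SilvermanAEC2009, Appendix C §11, V.2 and III.§1] -/
theorem frobeniusTrace_two_eq_zero_of_hasCM_of_goodSS_two (hCM : A.HasCM) (hss : GoodSS A 2) :
    A.frobeniusTrace 2 = 0 :=
  (frobeniusTrace_two_eq_zero_iff_dvd_c₄ A hss).mpr (thirtytwo_dvd_c₄_of_hasCM_of_goodSS_two A hCM hss)

end CM

/-! ## §3 The theta-habitat clauses need only `A.HasCM ∧ GoodSS A 2` -/

section Habitat

variable (W : WeierstrassCurve ℚ) (A : WeierstrassCurve ℚ) [A.IsElliptic] [A.IsGloballyMinimal]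

/-- **The habitat clause of `WAllNonCMAtTwoThetaHabitat` from `HasCM`, `GoodSS A 2`, rank `0` and the congruence**
— `a₂(A) = 0` supplied by §2. [cite: SilvermanAEC2009, Appendix C §11 and V.2] -/
theorem thetaHabitatClause_of_cm_goodSS (hACM : A.HasCM) (hAr : A.analyticRank = 0) (hAss : GoodSS A 2)
    (e : geomTorsion W (2 : ℤ) ≃+ geomTorsion A (2 : ℤ))
    (he : ∀ (σ : Field.absoluteGaloisGroup ℚ) (P : geomTorsion W (2 : ℤ)), e (σ • P) = σ • e P) :
    ∃ (A : WeierstrassCurve ℚ) (_ : A.IsElliptic) (_ : A.IsGloballyMinimal),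
      A.HasCM ∧ A.analyticRank = 0 ∧ GoodSS A 2 ∧ A.frobeniusTrace 2 = 0 ∧
        ∃ e : geomTorsion W (2 : ℤ) ≃+ geomTorsion A (2 : ℤ),
          ∀ (σ : Field.absoluteGaloisGroup ℚ) (P : geomTorsion W (2 : ℤ)), e (σ • P) = σ • e P :=
  ⟨A, ‹_›, ‹_›, hACM, hAr, hAss, frobeniusTrace_two_eq_zero_of_hasCM_of_goodSS_two A hACM hAss, e, he⟩

/-- **The unit-zone habitat clause of `thetaHabitatUnitZone_of_signedTransport_of_stubs` from `HasCM`, `GoodSS A 2`,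
the unit certificate and the congruence** — `a₂(A) = 0` supplied by §2. [cite: SilvermanAEC2009, Appendix C §11 and V.2] -/
theorem unitZoneClause_of_cm_goodSS (hACM : A.HasCM) (hAss : GoodSS A 2)
    (hunit : ∃ t : ℚ, A.entireLFunction 1 / (A.realPeriodRat : ℂ) = (t : ℂ) ∧ t ≠ 0 ∧ padicValRat 2 t = 0)
    (e : geomTorsion W (2 : ℤ) ≃+ geomTorsion A (2 : ℤ))
    (he : ∀ (σ : Field.absoluteGaloisGroup ℚ) (P : geomTorsion W (2 : ℤ)), e (σ • P) = σ • e P) :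
    ∃ (A : WeierstrassCurve ℚ) (_ : A.IsElliptic) (_ : A.IsGloballyMinimal),
      A.HasCM ∧ GoodSS A 2 ∧ A.frobeniusTrace 2 = 0 ∧
        (∃ t : ℚ, A.entireLFunction 1 / (A.realPeriodRat : ℂ) = (t : ℂ) ∧ t ≠ 0 ∧ padicValRat 2 t = 0) ∧
        ∃ e : geomTorsion W (2 : ℤ) ≃+ geomTorsion A (2 : ℤ),
          ∀ (σ : Field.absoluteGaloisGroup ℚ) (P : geomTorsion W (2 : ℤ)), e (σ • P) = σ • e P :=
  ⟨A, ‹_›, ‹_›, hACM, hAss, frobeniusTrace_two_eq_zero_of_hasCM_of_goodSS_two A hACM hAss, hunit, e, he⟩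

end Habitat

end ThetaPartnerXRoute

end Summit.BirchSwinnertonDyer.BirchSwinnertonDyer.Theorems

end
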